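import Summits.CriticalPhenomena.PercolationContinuityZ3.Theorems.PercNearOneGluingAdditiveGluingMultiEdgeLemma3Delta
import HarnessLib

/-! # Crux `PercNearOneGluing.AdditiveGluing` (stmt-CriticalPhenomena-4576) — the multi-edge Lemma 3 for a GLUED BLOCK
# (finger multi-edge Lemma 3 under the glued single-witness hypothesis; seat (b) V⁺-form, depth prover `png-dp-vplus`)

Support file (`--supports stmt-CriticalPhenomena-4576`); no definitions, no named facts.  Companion of
`…AdditiveGluingMultiEdgeLemma3.lean` (the case of a single vertex) and of the registered open stub `stub_fingerML3_vp`
(`…AdditiveGluingTFingers.lean`).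

`μ_g = prodBernoulli g` on the bond configurations of `Fin n`, where the block `N` is GLUED in `g` (`g = 1` on the non-loop pairs
inside `N`); `F` a set of "contact pairs" `s(v, a)`, `v ∈ N`, `a ∉ N`; `R = {some pair of F open}`; `τ(y) = μ_g(y ↔ b)`;
`τ⁰(y)` = reliability under `pinW g F ∅` (the contact pairs removed: the glued block cut off along `F`).

* `blockEdge_core`: for a pattern `J ⊆ F` containing `s(v, a)`: `τ⁰(c) ≤ τ⁰(a)` ⟹ under `pinW g F J` (pairs of `J` open, of
  `F ∖ J` closed) `μ(c ↔ b) ≤ μ(⋃_{s∈N} s ↔ b)` — the gluing form of Kozma–Nitzan's Lemma 5 for the CONNECTED edge set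
  `J ∪ clique(N)` (`glueEdges_lemma5_delta`), then `a ≡ v ∈ N`.
* `block_multiEdge_of_witness`: if `c` is `τ⁰`-below every contact relay (`τ⁰(c) ≤ τ⁰(a)` whenever `s(v,a) ∈ F`), `τ⁰(c) ≤ τ⁰(d)`
  and `τ(d) ≤ τ(c)`, then `μ_g(R ∩ {d ↔ b}) ≤ μ_g(R ∩ ⋃_{s∈N}{s ↔ b})` (pattern decomposition over `F`, as in `multiEdge_lemma3`).
* `block_multiEdge_singleWitness`: the same from ONE comparison `τ(d) ≤ τ(a⋆)` with a `τ⁰`-minimal contact relay `a⋆`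
  (case split `c = d` / `c = a⋆`).
For a finger block `N` (contact pairs = all pairs `N–A`) in the glued weighting `g = K/N` this is the conclusion of the finger
multi-edge Lemma 3 (FML3, `stub_fingerML3_vp`) under the GLUED hypothesis `μ_{K/N}(d ↔ b) ≤ μ_{K/N}(a⋆ ↔ b)`; the registered stub
asks for it under the UNGLUED hypothesis `μ_K(d ↔ b) ≤ μ_K(a ↔ b)` (`a ∈ A`), which the depth-prover numerics reduce to independent
finger blocks (seat NOTES; 0 failures in ≈ 3 000 exact instances) — that transfer is NOT proved here.
[cite: KozmaNitzan2024, Lemma 3(i) (pp. 6–7), Lemma 5 (p. 13), §3.2 pp. 12–14, Question 9 (p. 36)]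
-/

namespace Summit.CriticalPhenomena.PercolationContinuityZ3.Theorems

open MeasureTheory Set
open Literature.Probability.LatticeModels (prodBernoulli)
open Literature.Probability.Percolation (BondConfig openConn openGraph openEdgeCluster pinW localCylinder
  DeterminedBy determinedBy_iff)

noncomputable section
open Classical

section BlockMultiEdge

open Literature.Probability.LatticeModels Literature.Probability.Percolation

variable {n : ℕ}

/-- Under a weighting giving the pair `s(v, a)` (`v ≠ a`) weight `1`, `μ(a ↔ b) ≤ μ(⋃_{s∈N} s ↔ b)` for any `N ∋ v`
(`{a ↔ b} ⊆ {v ↔ b}` almost surely). [folklore] -/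
theorem blockEdge_openConn_le_iUnion_of_weight_one (p : Sym2 (Fin n) → unitInterval) (N : Finset (Fin n))
    {v a : Fin n} (b : Fin n) (hvN : v ∈ N) (hva : v ≠ a) (h1 : p s(v, a) = 1) :
    (prodBernoulli p).real (openConn a b) ≤ (prodBernoulli p).real (⋃ s ∈ N, openConn s b) := by
  have hae : ∀ᵐ ω ∂(prodBernoulli p), ω ∈ (openConn a b : Set (BondConfig (Fin n))) →
      ω ∈ (⋃ s ∈ N, openConn s b : Set (BondConfig (Fin n))) := by
    filter_upwards [prodBernoulli_ae_mem_of_eq_one p h1] with ω hω hab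
    refine Set.mem_iUnion₂.2 ⟨v, hvN, ?_⟩
    exact (SimpleGraph.Adj.reachable ((openGraph_adj ω v a).2 ⟨hω, hva⟩)).trans hab
  exact ENNReal.toReal_mono (measure_ne_top _ _) (measure_mono_ae hae)

/-- **Core of the block multi-edge Lemma 3.**  `g` glues the block `N` (weight `1` on the non-loop pairs inside `N`), `F` is a set
of contact pairs `s(v, a)` (`v ∈ N`, `a ∉ N`), `J ⊆ F` a pattern containing the contact pair `s(v, a)`.  If `c` is at most as
reliable as `a` under `pinW g F ∅` (contact pairs removed), then under `pinW g F J` (pairs of `J` open, of `F ∖ J` closed)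
`μ(c ↔ b) ≤ μ(⋃_{s∈N} s ↔ b)`.  Proof: `pinW g F J` is `pinW g F ∅` with the connected edge set `D = J ∪ clique(N)` glued; the
event "all of `D` open" is increasing in the open edge cluster of `a`, so the gluing form of Lemma 5 (`glueEdges_lemma5_delta`,
`δ = 0`) gives `μ(c ↔ b) ≤ μ(a ↔ b)`, and `a ≡ v ∈ N`. [cite: KozmaNitzan2024, Lemma 5 (p. 13), Lemma 3(i) (pp. 6–7)] -/
theorem blockEdge_core (g : Sym2 (Fin n) → unitInterval) (N : Finset (Fin n)) {F J : Finset (Sym2 (Fin n))}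
    (hF : ∀ e ∈ F, ∃ v ∈ N, ∃ a ∉ N, e = s(v, a))
    (hglue : ∀ u ∈ N, ∀ u' ∈ N, u ≠ u' → g s(u, u') = 1)
    (hJF : J ⊆ F) {v a : Fin n} (hvN : v ∈ N) (haN : a ∉ N) (hva : s(v, a) ∈ J) (c b : Fin n)
    (hle : (prodBernoulli (pinW g (↑F : Set (Sym2 (Fin n))) ↑(∅ : Finset (Sym2 (Fin n))))).real (openConn c b) ≤
      (prodBernoulli (pinW g (↑F : Set (Sym2 (Fin n))) ↑(∅ : Finset (Sym2 (Fin n))))).real (openConn a b)) :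
    (prodBernoulli (pinW g (↑F : Set (Sym2 (Fin n))) ↑J)).real (openConn c b) ≤
      (prodBernoulli (pinW g (↑F : Set (Sym2 (Fin n))) ↑J)).real (⋃ s ∈ N, openConn s b) := by
  have hva' : v ≠ a := fun h => haN (h ▸ hvN)
  -- the glued edge set `D = J ∪ clique(N)`
  set C : Finset (Sym2 (Fin n)) := Finset.univ.filter (fun e => (∀ y ∈ e, y ∈ N) ∧ ¬ e.IsDiag) with hCdef
  set D : Finset (Sym2 (Fin n)) := J ∪ C with hDdef
  set w₀ : Sym2 (Fin n) → unitInterval := pinW g (↑F : Set (Sym2 (Fin n))) ↑(∅ : Finset (Sym2 (Fin n))) with hw₀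
  -- no clique pair is a contact pair
  have hCF : ∀ e ∈ C, e ∉ F := by
    intro e heC heF
    obtain ⟨hin, -⟩ := (Finset.mem_filter.1 heC).2
    obtain ⟨v', -, a', ha'N, rfl⟩ := hF e heF
    exact ha'N (hin a' (Sym2.mem_mk_right v' a'))
  -- `pinW g F J` is `w₀` glued along `D`
  have hpin : pinW g (↑F : Set (Sym2 (Fin n))) ↑J = fun e => if e ∈ D then (1 : unitInterval) else w₀ e := by
    funext e
    by_cases heJ : e ∈ J
    · rw [pinW_apply_of_mem_of_mem g (Finset.mem_coe.2 (hJF heJ)) (Finset.mem_coe.2 heJ),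
        if_pos (Finset.mem_union_left C heJ)]
    · by_cases heC : e ∈ C
      · rw [if_pos (Finset.mem_union_right J heC),
          pinW_apply_of_not_mem g _ (fun h => hCF e heC (Finset.mem_coe.1 h))]
        obtain ⟨hin, hnd⟩ := (Finset.mem_filter.1 heC).2
        induction e using Sym2.ind with
        | h u u' =>
          exact hglue u (hin u (Sym2.mem_mk_left u u')) u' (hin u' (Sym2.mem_mk_right u u'))
            (fun h => hnd (Sym2.mk_isDiag_iff.2 h))
      · have heD : e ∉ D := fun h => (Finset.mem_union.1 h).elim heJ heC
        rw [if_neg heD, hw₀]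
        by_cases heF : e ∈ F
        · rw [pinW_apply_of_mem_of_not_mem g (Finset.mem_coe.2 heF) (fun h => heJ (Finset.mem_coe.1 h)),
            pinW_apply_of_mem_of_not_mem g (Finset.mem_coe.2 heF) (by simp)]
        · rw [pinW_apply_of_not_mem g _ (fun h => heF (Finset.mem_coe.1 h)),
            pinW_apply_of_not_mem g _ (fun h => heF (Finset.mem_coe.1 h))]
  -- "all of `D` open" is increasing in the open edge cluster of `a`
  have hmono : ∀ ω ω' : Set (Sym2 (Fin n)),
      ω ∈ {ω : Set (Sym2 (Fin n)) | (↑D : Set (Sym2 (Fin n))) ⊆ ω} →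
        openEdgeCluster ω a ⊆ openEdgeCluster ω' a →
          ω' ∈ {ω : Set (Sym2 (Fin n)) | (↑D : Set (Sym2 (Fin n))) ⊆ ω} := by
    intro ω ω' hω hsub e heD
    -- under `ω ⊇ D`, `a` reaches `v` and every vertex of `N`
    have hav : (openGraph ω).Reachable a v := by
      refine SimpleGraph.Adj.reachable ((openGraph_adj ω a v).2 ⟨?_, hva'.symm⟩)
      rw [Sym2.eq_swap]
      exact hω (Finset.mem_coe.2 (Finset.mem_union_left C hva))
    have haN' : ∀ u ∈ N, (openGraph ω).Reachable a u := by
      intro u huN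
      by_cases huv : u = v
      · exact huv ▸ hav
      · refine hav.trans (SimpleGraph.Adj.reachable ((openGraph_adj ω v u).2 ⟨?_, fun h => huv h.symm⟩))
        refine hω (Finset.mem_coe.2 (Finset.mem_union_right J (Finset.mem_filter.2 ⟨Finset.mem_univ _, ?_, ?_⟩)))
        · intro y hy
          rcases Sym2.mem_iff.1 hy with rfl | rfl
          · exact hvN
          · exact huN
        · exact fun h => huv (Sym2.mk_isDiag_iff.1 h).symm
    refine openEdgeCluster_subset ω' a (hsub ?_)
    rw [mem_openEdgeCluster_iff]
    refine ⟨hω heD, ?_, ?_⟩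
    · -- non-loop
      rcases Finset.mem_union.1 (Finset.mem_coe.1 heD) with heJ | heC
      · obtain ⟨v', hv'N, a', ha'N, rfl⟩ := hF e (hJF heJ)
        exact fun h => ha'N ((Sym2.mk_isDiag_iff.1 h) ▸ hv'N)
      · exact ((Finset.mem_filter.1 heC).2).2
    · -- both endpoints joined to `a`
      intro y hy
      rcases Finset.mem_union.1 (Finset.mem_coe.1 heD) with heJ | heC
      · obtain ⟨v', hv'N, a', ha'N, he⟩ := hF e (hJF heJ)
        subst he
        rcases Sym2.mem_iff.1 hy with rfl | rfl
        · exact haN' y hv'N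
        · exact (haN' v' hv'N).trans
            (SimpleGraph.Adj.reachable ((openGraph_adj ω v' y).2 ⟨hω heD, fun h => ha'N (h ▸ hv'N)⟩))
      · exact haN' y (((Finset.mem_filter.1 heC).2).1 y hy)
  -- gluing Lemma 5 along `D` from `w₀`, then `a ≡ v ∈ N`
  have h5 := glueEdges_lemma5_delta w₀ D c a b hmono le_rfl (by simpa [hw₀] using hle)
  rw [hpin]
  rw [add_zero] at h5
  refine h5.trans (blockEdge_openConn_le_iUnion_of_weight_one _ N b hvN hva' ?_)
  simp only [show s(v, a) ∈ D from Finset.mem_union_left C hva, if_true]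

/-- **Block multi-edge Lemma 3 from one witness vertex.**  `g` glues `N`; `F` = contact pairs `s(v,a)` (`v ∈ N`, `a ∉ N`);
`R` = some contact pair open; `τ⁰` = reliability under `pinW g F ∅`.  If `τ⁰(c) ≤ τ⁰(a)` for every contact relay `a`,
`τ⁰(c) ≤ τ⁰(d)` and `μ_g(d ↔ b) ≤ μ_g(c ↔ b)`, then `μ_g(R ∩ {d ↔ b}) ≤ μ_g(R ∩ ⋃_{s∈N} {s ↔ b})`.
Proof as `multiEdge_lemma3` (pattern decomposition over `F`, `blockEdge_core` on every pattern meeting `R`,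
`μ(R, d↔b) = τ(d) − μ[∅]τ⁰(d) ≤ τ(c) − μ[∅]τ⁰(c) = μ(R, c↔b)`). [cite: KozmaNitzan2024, Lemma 3(i) (pp. 6–7), Lemma 5 (p. 13)] -/
theorem block_multiEdge_of_witness (g : Sym2 (Fin n) → unitInterval) (N : Finset (Fin n)) (F : Finset (Sym2 (Fin n)))
    (hF : ∀ e ∈ F, ∃ v ∈ N, ∃ a ∉ N, e = s(v, a))
    (hglue : ∀ u ∈ N, ∀ u' ∈ N, u ≠ u' → g s(u, u') = 1)
    (d c b : Fin n)
    (hcT : ∀ v ∈ N, ∀ a ∉ N, s(v, a) ∈ F →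
      (prodBernoulli (pinW g (↑F : Set (Sym2 (Fin n))) ↑(∅ : Finset (Sym2 (Fin n))))).real (openConn c b) ≤
        (prodBernoulli (pinW g (↑F : Set (Sym2 (Fin n))) ↑(∅ : Finset (Sym2 (Fin n))))).real (openConn a b))
    (hcd : (prodBernoulli (pinW g (↑F : Set (Sym2 (Fin n))) ↑(∅ : Finset (Sym2 (Fin n))))).real (openConn c b) ≤
      (prodBernoulli (pinW g (↑F : Set (Sym2 (Fin n))) ↑(∅ : Finset (Sym2 (Fin n))))).real (openConn d b))
    (hdc : (prodBernoulli g).real (openConn d b) ≤ (prodBernoulli g).real (openConn c b)) :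
    (prodBernoulli g).real ({ω : Set (Sym2 (Fin n)) | ∃ e ∈ F, e ∈ ω} ∩ openConn d b) ≤
      (prodBernoulli g).real ({ω : Set (Sym2 (Fin n)) | ∃ e ∈ F, e ∈ ω} ∩ ⋃ s ∈ N, openConn s b) := by
  set R : Set (Set (Sym2 (Fin n))) := {ω | ∃ e ∈ F, e ∈ ω} with hRdef
  set U : Set (BondConfig (Fin n)) := ⋃ s ∈ N, openConn s b with hUdef
  set w₀ : Sym2 (Fin n) → unitInterval := pinW g ↑F ↑(∅ : Finset (Sym2 (Fin n))) with hw₀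
  set τ₀ : Fin n → ℝ := fun v => (prodBernoulli w₀).real (openConn v b) with hτ₀
  have hcd' : τ₀ c ≤ τ₀ d := hcd
  -- (i) CORE on every pattern meeting `R`
  have hcore : ∀ J : Finset (Sym2 (Fin n)), J ⊆ F → (↑J : Set (Sym2 (Fin n))) ∈ R →
      (prodBernoulli (pinW g ↑F ↑J)).real (openConn c b) ≤ (prodBernoulli (pinW g ↑F ↑J)).real U := by
    intro J hJF hJR
    obtain ⟨e, heF, heJ⟩ := hJR
    have heJ' : e ∈ J := Finset.mem_coe.1 heJ
    obtain ⟨v, hvN, a, haN, rfl⟩ := hF e heF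
    exact blockEdge_core g N hF hglue hJF hvN haN heJ' c b (hcT v hvN a haN heF)
  -- law of total probability over the patterns of `F`, for `R` and for `Rᶜ`
  have hRm : MeasurableSet R := MeasurableSet.of_discrete
  have hdet : DeterminedBy R (↑F : Set (Sym2 (Fin n))) := DepthOneGluing.determinedBy_exists_mem F
  have hdetC : DeterminedBy Rᶜ (↑F : Set (Sym2 (Fin n))) := determinedBy_forall_not_mem F
  have hdec := fun (X : Set (BondConfig (Fin n))) =>
    prodBernoulli_real_inter_eq_sum_pinW g F (A := X) (B := R) MeasurableSet.of_discrete hdet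
  have hdecC := fun v : Fin n =>
    prodBernoulli_real_inter_eq_sum_pinW g F (A := openConn v b) (B := Rᶜ) MeasurableSet.of_discrete hdetC
  have hN : ∀ v : Fin n, (prodBernoulli g).real (openConn v b ∩ Rᶜ) =
      (prodBernoulli g).real (localCylinder ↑F ↑(∅ : Finset (Sym2 (Fin n)))) * τ₀ v := by
    intro v
    rw [hdecC v]
    refine Finset.sum_eq_single_of_mem ∅ ?_ ?_
    · refine (@Finset.mem_filter _ _ (_) _ _).2 ⟨Finset.mem_powerset.2 (Finset.empty_subset F), ?_⟩
      rintro ⟨e, -, he⟩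
      exact Finset.notMem_empty e (Finset.mem_coe.1 he)
    · intro J hJ hne
      exfalso
      obtain ⟨hJF, hno⟩ := (@Finset.mem_filter _ _ (_) _ _).1 hJ
      obtain ⟨e, heJ⟩ := Finset.nonempty_iff_ne_empty.2 hne
      exact hno ⟨e, Finset.mem_powerset.1 hJF heJ, Finset.mem_coe.2 heJ⟩
  have hsplit : ∀ v : Fin n, (prodBernoulli g).real (openConn v b ∩ R) +
      (prodBernoulli g).real (openConn v b ∩ Rᶜ) = (prodBernoulli g).real (openConn v b) :=
    fun v => measureReal_inter_add_sdiff (μ := prodBernoulli g) (s := openConn v b) hRm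
  -- (ii) `μ(c↔b, R) ≤ μ(U, R)` termwise
  have hcx : (prodBernoulli g).real (openConn c b ∩ R) ≤ (prodBernoulli g).real (U ∩ R) := by
    rw [hdec (openConn c b), hdec U]
    refine Finset.sum_le_sum fun J hJ => mul_le_mul_of_nonneg_left ?_ measureReal_nonneg
    obtain ⟨hJF, hJR⟩ := (@Finset.mem_filter _ _ (_) _ _).1 hJ
    exact hcore J (Finset.mem_powerset.1 hJF) hJR
  -- (iii) `μ(d↔b, R) ≤ μ(c↔b, R)` from `τ(d) ≤ τ(c)` and `τ⁰(c) ≤ τ⁰(d)`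
  have hdc' : (prodBernoulli g).real (openConn d b ∩ R) ≤ (prodBernoulli g).real (openConn c b ∩ R) := by
    have hd := hsplit d
    have hc' := hsplit c
    rw [hN] at hd hc'
    have hmono : (prodBernoulli g).real (localCylinder ↑F ↑(∅ : Finset (Sym2 (Fin n)))) * τ₀ c ≤
        (prodBernoulli g).real (localCylinder ↑F ↑(∅ : Finset (Sym2 (Fin n)))) * τ₀ d :=
      mul_le_mul_of_nonneg_left hcd' measureReal_nonneg
    linarith
  rw [Set.inter_comm R (openConn d b), Set.inter_comm R U]
  exact hdc'.trans hcx

/-- **Block multi-edge Lemma 3 with a SINGLE witness** (glued-hypothesis form of the finger multi-edge Lemma 3).  `g` glues `N`;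
`F` = contact pairs; `R` = some contact pair open; `τ⁰` = reliability under `pinW g F ∅`.  If `a⋆` is `τ⁰`-below every contact
relay (`τ⁰(a⋆) ≤ τ⁰(a)` whenever `s(v,a) ∈ F`) and `μ_g(d ↔ b) ≤ μ_g(a⋆ ↔ b)`, then
`μ_g(R ∩ {d ↔ b}) ≤ μ_g(R ∩ ⋃_{s∈N}{s ↔ b})`.  (Case split: `c = d` if `τ⁰(d) ≤ τ⁰(a⋆)`, else `c = a⋆`.)
[cite: KozmaNitzan2024, Lemma 3(i) (pp. 6–7), Lemma 5 (p. 13), Question 9 (p. 36)] -/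
theorem block_multiEdge_singleWitness (g : Sym2 (Fin n) → unitInterval) (N : Finset (Fin n)) (F : Finset (Sym2 (Fin n)))
    (hF : ∀ e ∈ F, ∃ v ∈ N, ∃ a ∉ N, e = s(v, a))
    (hglue : ∀ u ∈ N, ∀ u' ∈ N, u ≠ u' → g s(u, u') = 1)
    (d astar b : Fin n)
    (hstar : ∀ v ∈ N, ∀ a ∉ N, s(v, a) ∈ F →
      (prodBernoulli (pinW g (↑F : Set (Sym2 (Fin n))) ↑(∅ : Finset (Sym2 (Fin n))))).real (openConn astar b) ≤
        (prodBernoulli (pinW g (↑F : Set (Sym2 (Fin n))) ↑(∅ : Finset (Sym2 (Fin n))))).real (openConn a b))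
    (hle : (prodBernoulli g).real (openConn d b) ≤ (prodBernoulli g).real (openConn astar b)) :
    (prodBernoulli g).real ({ω : Set (Sym2 (Fin n)) | ∃ e ∈ F, e ∈ ω} ∩ openConn d b) ≤
      (prodBernoulli g).real ({ω : Set (Sym2 (Fin n)) | ∃ e ∈ F, e ∈ ω} ∩ ⋃ s ∈ N, openConn s b) := by
  by_cases hcase :
      (prodBernoulli (pinW g (↑F : Set (Sym2 (Fin n))) ↑(∅ : Finset (Sym2 (Fin n))))).real (openConn d b) ≤
        (prodBernoulli (pinW g (↑F : Set (Sym2 (Fin n))) ↑(∅ : Finset (Sym2 (Fin n))))).real (openConn astar b)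
  · exact block_multiEdge_of_witness g N F hF hglue d d b
      (fun v hv a ha he => hcase.trans (hstar v hv a ha he)) le_rfl le_rfl
  · exact block_multiEdge_of_witness g N F hF hglue d astar b hstar (le_of_lt (not_le.1 hcase)) hle


/-- Registered rung `stub_blockMultiEdgeSingleWitness_vp` of crux stmt-CriticalPhenomena-4576 (depth prover png-dp-vplus, seat (b) V⁺-form): the block multi-edge Lemma 3 with a single witness (finger multi-edge Lemma 3 under the glued hypothesis) — `block_multiEdge_singleWitness`, closed statement. [cite: KozmaNitzan2024, Lemma 3(i) (pp. 6–7), Lemma 5 (p. 13)] -/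
theorem stub_blockMultiEdgeSingleWitness_vp : ∀ (n : ℕ) (g : Sym2 (Fin n) → unitInterval) (N : Finset (Fin n)) (F : Finset (Sym2 (Fin n))) (d astar b : Fin n), (∀ e ∈ F, ∃ v ∈ N, ∃ a ∉ N, e = s(v, a)) → (∀ u ∈ N, ∀ u' ∈ N, u ≠ u' → g s(u, u') = 1) → (∀ v ∈ N, ∀ a ∉ N, s(v, a) ∈ F → (Literature.Probability.LatticeModels.prodBernoulli (Literature.Probability.Percolation.pinW g (↑F : Set (Sym2 (Fin n))) ↑(∅ : Finset (Sym2 (Fin n))))).real (Literature.Probability.Percolation.openConn astar b) ≤ (Literature.Probability.LatticeModels.prodBernoulli (Literature.Probability.Percolation.pinW g (↑F : Set (Sym2 (Fin n))) ↑(∅ : Finset (Sym2 (Fin n))))).real (Literature.Probability.Percolation.openConn a b)) → (Literature.Probability.LatticeModels.prodBernoulli g).real (Literature.Probability.Percolation.openConn d b) ≤ (Literature.Probability.LatticeModels.prodBernoulli g).real (Literature.Probability.Percolation.openConn astar b) → (Literature.Probability.LatticeModels.prodBernoulli g).real ({ω : Set (Sym2 (Fin n)) | ∃ e ∈ F, e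 ∈ ω} ∩ Literature.Probability.Percolation.openConn d b) ≤ (Literature.Probability.LatticeModels.prodBernoulli g).real ({ω : Set (Sym2 (Fin n)) | ∃ e ∈ F, e ∈ ω} ∩ ⋃ s ∈ N, Literature.Probability.Percolation.openConn s b) :=
  fun _ g N F d astar b hF hglue hstar hle => block_multiEdge_singleWitness g N F hF hglue d astar b hstar hle

end BlockMultiEdge

end

end Summit.CriticalPhenomena.PercolationContinuityZ3.Theorems
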